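import Summits.ValiantsHypothesis.ValiantsHypothesis.Theorems.BarrierLeverPartitionMinorsChowSizeFiveBridge
import Summits.ValiantsHypothesis.ValiantsHypothesis.Theorems.BarrierLeverPartitionMinorsChowCoreEngine
import Summits.ValiantsHypothesis.ValiantsHypothesis.Theorems.BarrierLeverPartitionMinorsChowSwap

/-!
# Route BarrierLever — Chow witnesses for partition minors (item 20172, CPM): ALL partition minors of
# SIZE `r ≤ 5` are hit, at EVERY height

Helper file (`--supports stmt-ValiantsHypothesis-20172`; cell valiant-natproofs, rung V4, 𝒟-side of
door (c); seat val-np-p4 gen 12; planner valiant-natproofs-p1 g15 round-close l.723 / director g7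
l.725 docket «the (4,5) core against a fixed table ⇒ `chowHits_of_size_le_five`»).  Closes NO item.
Conventions of items 19717 / 20172 / 20195: a layout `(u, w)` of height `h` (`u w : Fin r → Finset
(Fin h)`) is HIT when some product of `h + h` affine forms has nonsingular partition minor
`det[coeff_{E (u i) (w j)} ∏ ℓ]`.

* `chow_hit_of_t6` — a nonzero Laplace determinant of a minor of the certified table of `T₆`
  (`t6Rows = t6Final`, `coeff_t6_eq_table`) makes the product of the eight `0/1` forms of `T₆` a
  witness for the coded layout;
* **`chow_hit_dclass_star`** — the `(4, 5)` core case: rows in the degree class (no literal class of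
  size `1` or `4`) against a star (no literal class of size `2` or `3`) are hit — the rows are a
  coordinate permutation of one of the `95` normal forms (`normalForm_kernel`), the columns a
  coordinate permutation of a canonical star (`star_kernel`, `centre_kernel`), the `475` certificates
  (`rep95_certified`) hit the normal-form layout, and `chow_hit_relabel` / `chow_hit_of_perm` carry
  the witness back;
* **`chow_hit_locked_four_five`** — every LOCKED injective layout pair `Fin 5 → Finset (Fin 4)` is
  hit (degree bookkeeping: lockedness separates the two degree sets, `someDegree_kernel` puts one
  side in the degree class and the other in the star class; `chow_hit_swap` for the mirror case);
* `chow_hit_of_core_le` — the core engine `chow_hit_of_core` with the size bound `r ≤ R` threaded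
  (the peel keeps the size, a split lowers it);
* **`chowHits_of_size_le_five`** — **item 20172's conclusion for every injective layout pair of size
  `r ≤ 5`, at EVERY height `h`**: a core layout has `h + 1 ≤ r ≤ 5`, so it lies in the height slice
  `h ≤ 3` (`chowHits_of_height_le_three`) or is the `(4, 5)` core.

WHAT THIS IS NOT: a bounded-size slice; item 20172 asks for minors of every size `r ≤ 2^h`; nothing on
items 20195 / 19717, on crux stmt-ValiantsHypothesis-14610, or on `VP` versus `VNP`.
-/

set_option linter.dupNamespace false

namespace Summit.ValiantsHypothesis.ValiantsHypothesis.Theorems.BarrierLever.ChowFactor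

open Finset MvPolynomial
open Summit.ValiantsHypothesis.ValiantsHypothesis.Theorems.BarrierLever.Compression
  (exists_blockPerm)

noncomputable section

/-! ## G1. From a certificate to a Chow witness for the normal-form layout -/

/-- **Table certificate ⇒ hit.**  If the Laplace determinant of the `T₆`-table minor on row codes
`ru` and column codes `cw` (all `< 16`) is nonzero, the product of the eight forms of `T₆` hits the
layout `(decode4 ∘ ru, decode4 ∘ cw)`. -/
theorem chow_hit_of_t6 (ru cw : Fin 5 → ℕ) (hru : ∀ i, ru i < 16) (hcw : ∀ j, cw j < 16)
    (hdet : detL 5 (fun i j => t6R (ru i) (cw j)) ≠ 0) :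
    ∃ ℓ : Fin (4 + 4) → MvPolynomial (Fin (4 + 4)) ℂ, (∀ q, (ℓ q).totalDegree ≤ 1) ∧
      (Matrix.of fun i j : Fin 5 => coeff
        (∑ b ∈ decode4 (ru i), Finsupp.single (Fin.castAdd 4 b) 1 +
          ∑ d ∈ decode4 (cw j), Finsupp.single (Fin.natAdd 4 d) 1)
        (∏ q, ℓ q)).det ≠ 0 := by
  classical
  refine ⟨fun q => intForm ℂ (fun _ => 1) (t6Tab t6A) (t6Tab t6B) (q : ℕ),
    fun q => totalDegree_intForm_le ℂ _ _ _ _, ?_⟩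
  set Z : Matrix (Fin 5) (Fin 5) ℤ := Matrix.of fun i j => t6R (ru i) (cw j) with hZ
  have hZdet : Z.det ≠ 0 := by
    rw [hZ, ← detL_eq_det]
    exact hdet
  have hprod : (∏ q : Fin (4 + 4), intForm ℂ (fun _ => 1) (t6Tab t6A) (t6Tab t6B) (q : ℕ)) =
      ∏ k ∈ Finset.range (4 + 4), intForm ℂ (fun _ => 1) (t6Tab t6A) (t6Tab t6B) k :=
    Fin.prod_univ_eq_prod_range (fun k => intForm ℂ (fun _ => (1 : ℤ)) (t6Tab t6A) (t6Tab t6B) k)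
      (4 + 4)
  have hmat : (Matrix.of fun i j : Fin 5 => coeff
      (∑ b ∈ decode4 (ru i), Finsupp.single (Fin.castAdd 4 b) 1 +
        ∑ d ∈ decode4 (cw j), Finsupp.single (Fin.natAdd 4 d) 1)
      (∏ q : Fin (4 + 4), intForm ℂ (fun _ => 1) (t6Tab t6A) (t6Tab t6B) (q : ℕ))) =
      (Int.castRingHom ℂ).mapMatrix Z := by
    ext i j
    rw [Matrix.of_apply, hprod, coeff_t6_eq_table, RingHom.mapMatrix_apply, Matrix.map_apply, hZ,
      Matrix.of_apply]
    have e1 : code4 (decode4 (ru i)) = ⟨ru i, hru i⟩ := Fin.ext (code4_decode4 ⟨ru i, hru i⟩)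
    have e2 : code4 (decode4 (cw j)) = ⟨cw j, hcw j⟩ := Fin.ext (code4_decode4 ⟨cw j, hcw j⟩)
    rw [e1, e2, ← t6R_eq]
    rfl
  rw [hmat, ← RingHom.map_det]
  exact (map_ne_zero_iff _ (RingHom.injective_int _)).mpr hZdet

/-! ## G2. The main lemma: (degree class) × (star) is hit -/

/-- **Main lemma for the `(4, 5)` core.**  An injective `5`-family `u` of subsets of `Fin 4` with no
literal class of size `1` or `4` (the degree class), against an injective `5`-family `w` with no
literal class of size `2` or `3` (a star), is hit: `u` is a coordinate permutation of a normal form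
`rep ∈ rep95L` (`normalForm_kernel`), `w` is a coordinate permutation of a canonical star
(`star_kernel`, `centre_kernel`), the table `T₆` certifies the normal-form layout
(`rep95_certified`, `chow_hit_of_t6`), and `chow_hit_relabel` / `chow_hit_of_perm` carry the
witness back. -/
theorem chow_hit_dclass_star (u w : Fin 5 → Finset (Fin 4)) (hu : Function.Injective u)
    (hw : Function.Injective w)
    (hU : ∀ a : Fin 4, (Finset.univ.filter fun i => a ∈ u i).card ≠ 1 ∧
      (Finset.univ.filter fun i => a ∈ u i).card ≠ 4)
    (hW : ∀ c : Fin 4, (Finset.univ.filter fun j => c ∈ w j).card ≠ 2 ∧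
      (Finset.univ.filter fun j => c ∈ w j).card ≠ 3) :
    ∃ ℓ : Fin (4 + 4) → MvPolynomial (Fin (4 + 4)) ℂ, (∀ q, (ℓ q).totalDegree ≤ 1) ∧
      (Matrix.of fun i j : Fin 5 => coeff
        (∑ b ∈ u i, Finsupp.single (Fin.castAdd 4 b) 1 + ∑ d ∈ w j, Finsupp.single (Fin.natAdd 4 d) 1)
        (∏ q, ℓ q)).det ≠ 0 := by
  classical
  obtain ⟨t, σ, ht, ht16, htc⟩ := exists_sortedCodes u hu
  obtain ⟨s, τ, hs, hs16, hsc⟩ := exists_sortedCodes w hw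
  -- (C′): `u` is a permuted normal form
  have hC := allSorted5_spec normalForm_kernel t ht ht16
  rw [avoidsL_sortedCodes u t σ htc 1 4 hU, Bool.not_true, Bool.false_or] at hC
  obtain ⟨rep, hrep, row, hrow, hmask⟩ := exists_of_coverMask hC
  obtain ⟨g, hg⟩ := exists_fin24_of_mem_permCodeTab hrow
  obtain ⟨hlen, hlt⟩ := rep95L_getD_lt hrep
  have hmemU : ∀ x, (∃ i, (code4 (u i) : ℕ) = x) ↔ ∃ i : Fin 5, pc g (rep.getD i 0) = x := by
    intro x
    rw [← mem_sortedCodes u t σ htc x, ← mem_iff_of_maskL_eq hmask x, List.mem_map]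
    constructor
    · rintro ⟨y, hy, rfl⟩
      obtain ⟨i, rfl⟩ := (mem_iff_getD_of_length hlen y).mp hy
      exact ⟨i, by rw [pc, hg]⟩
    · rintro ⟨i, rfl⟩
      exact ⟨rep.getD i 0, (mem_iff_getD_of_length hlen _).mpr ⟨i, rfl⟩, by rw [pc, hg]⟩
  -- (B′): `w` is a star
  have hB := allSorted5_spec star_kernel s hs hs16
  rw [avoidsL_sortedCodes w s τ hsc 2 3 hW, Bool.not_true, Bool.false_or] at hB
  obtain ⟨b, hb, hbeq⟩ := List.any_eq_true.mp hB
  have hb16 : b < 16 := List.mem_range.mp hb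
  have hmemW : ∀ x, (∃ j, (code4 (w j) : ℕ) = x) ↔ x ∈ starList b := by
    intro x
    rw [← mem_sortedCodes w s τ hsc x, beq_iff_eq.mp hbeq]
    exact (List.perm_insertionSort _ _).mem_iff
  -- centre normalisation
  obtain ⟨g₂, c, hc, hmemC⟩ := exists_centre b hb16
  have hcw : ∀ j, starCode c j < 16 := starCode_canon_lt c hc
  -- the normal-form layout is hit, and relabelled
  have h0 := chow_hit_of_t6 (fun i => rep.getD i 0) (starCode c) hlt hcw (detL_ne_zero_of_mem hrep hc)
  have h1 := chow_hit_relabel (perm4 g) (perm4 (permInv4 g₂)) _ _ h0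
  -- rows: `u ∘ σ₁ = (perm4 g) • (decode4 ∘ rep)`
  obtain ⟨σ₁, hσ₁⟩ := exists_perm_of_range_eq u
    (fun i => (decode4 (rep.getD i 0)).map (perm4 g).toEmbedding) hu (fun X => by
      rw [show (∃ i, u i = X) ↔ ∃ i, (code4 (u i) : ℕ) = code4 X from
        ⟨fun ⟨i, e⟩ => ⟨i, by rw [e]⟩, fun ⟨i, e⟩ => ⟨i, code4_injective (Fin.ext e)⟩⟩, hmemU]
      have hcode : ∀ i : Fin 5, (code4 ((decode4 (rep.getD i 0)).map (perm4 g).toEmbedding) : ℕ) =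
          pc g (rep.getD i 0) := fun i => by
        rw [code4_map_perm4, code4_decode4 ⟨_, hlt i⟩]
      constructor
      · rintro ⟨i, e⟩
        exact ⟨i, code4_injective (Fin.ext (by rw [hcode, e]))⟩
      · rintro ⟨i, rfl⟩
        exact ⟨i, (hcode i).symm⟩)
  -- columns: `w ∘ τ₁ = (perm4 g₂)⁻¹ • (decode4 ∘ starCode c)`
  obtain ⟨τ₁, hτ₁⟩ := exists_perm_of_range_eq w
    (fun j => (decode4 (starCode c j)).map (perm4 (permInv4 g₂)).toEmbedding) hw (fun X => by
      rw [show (∃ j, w j = X) ↔ ∃ j, (code4 (w j) : ℕ) = code4 X from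
        ⟨fun ⟨j, e⟩ => ⟨j, by rw [e]⟩, fun ⟨j, e⟩ => ⟨j, code4_injective (Fin.ext e)⟩⟩, hmemW]
      have hcode : ∀ j : Fin 5,
          (code4 ((decode4 (starCode c j)).map (perm4 (permInv4 g₂)).toEmbedding) : ℕ) =
          pc (permInv4 g₂) (starCode c j) := fun j => by
        rw [code4_map_perm4, code4_decode4 ⟨_, hcw j⟩]
      constructor
      · intro hX
        have h2 : pc g₂ (code4 X) ∈ starList c := (hmemC _).mp ⟨_, hX, rfl⟩
        obtain ⟨j, hj⟩ := (mem_starList c _).mp h2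
        refine ⟨j, code4_injective (Fin.ext ?_)⟩
        rw [hcode, hj]
        exact (pc_inv g₂ (code4 X)).1
      · rintro ⟨j, rfl⟩
        rw [hcode]
        obtain ⟨y, hy, hyx⟩ := (hmemC _).mpr ((mem_starList c _).mpr ⟨j, rfl⟩)
        have hy16 : y < 16 := starList_lt b (List.mem_range.mpr hb16) y hy
        have hinv := (pc_inv g₂ ⟨y, hy16⟩).1
        rw [← hyx]
        rw [Fin.val_mk] at hinv
        rw [hinv]
        exact hy)
  refine chow_hit_of_perm u w σ₁ τ₁ ?_
  simp only [hσ₁, hτ₁]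
  exact h1

/-! ## G3. The locked `(h = 4, r = 5)` core -/

/-- An injective `5`-family has a literal class of size neither `0` nor `5` (kernel check A′). -/
theorem exists_midDegree (f : Fin 5 → Finset (Fin 4)) (hf : Function.Injective f) :
    ∃ a : Fin 4, (Finset.univ.filter fun i => a ∈ f i).card ≠ 0 ∧
      (Finset.univ.filter fun i => a ∈ f i).card ≠ 5 := by
  obtain ⟨t, σ, ht, ht16, htc⟩ := exists_sortedCodes f hf
  have h := allSorted5_spec someDegree_kernel t ht ht16
  obtain ⟨a, ha, h⟩ := List.any_eq_true.mp h
  have ha4 := List.mem_range.mp ha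
  refine ⟨⟨a, ha4⟩, ?_⟩
  rw [← degL_sortedCodes f t σ htc ⟨a, ha4⟩]
  simpa [Bool.and_eq_true, bne_iff_ne] using h

/-- **The `(4, 5)` core.**  Every LOCKED injective layout pair `u w : Fin 5 → Finset (Fin 4)` is hit:
lockedness makes the row and column degree sets avoid each other and each other's complements, so
(by `exists_midDegree`) one side is in the degree class and the other is a star
(`chow_hit_dclass_star`, with `chow_hit_swap` for the mirrored case). -/
theorem chow_hit_locked_four_five (u w : Fin 5 → Finset (Fin 4)) (hu : Function.Injective u)
    (hw : Function.Injective w)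
    (hlk : ∀ (a c : Fin 4) (β γ : Bool),
      (Finset.univ.filter fun i => (a ∈ u i ↔ β = true)).card ≠
        (Finset.univ.filter fun j => (c ∈ w j ↔ γ = true)).card) :
    ∃ ℓ : Fin (4 + 4) → MvPolynomial (Fin (4 + 4)) ℂ, (∀ q, (ℓ q).totalDegree ≤ 1) ∧
      (Matrix.of fun i j : Fin 5 => coeff
        (∑ b ∈ u i, Finsupp.single (Fin.castAdd 4 b) 1 + ∑ d ∈ w j, Finsupp.single (Fin.natAdd 4 d) 1)
        (∏ q, ℓ q)).det ≠ 0 := by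
  classical
  -- the lock in terms of degrees
  have lock1 : ∀ a c : Fin 4, (Finset.univ.filter fun i => a ∈ u i).card ≠
      (Finset.univ.filter fun j => c ∈ w j).card := fun a c => by
    have e := hlk a c true true
    rwa [card_filter_iff_eq, card_filter_iff_eq, if_pos rfl, if_pos rfl] at e
  have lock2 : ∀ a c : Fin 4, (Finset.univ.filter fun i => a ∈ u i).card +
      (Finset.univ.filter fun j => c ∈ w j).card ≠ 5 := fun a c => by
    have e := hlk a c true false
    rw [card_filter_iff_eq, card_filter_iff_eq, if_pos rfl, if_neg Bool.false_ne_true] at e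
    have s := card_filter_mem_add_card_filter_not_mem w c
    omega
  have bu : ∀ a : Fin 4, (Finset.univ.filter fun i => a ∈ u i).card ≤ 5 := fun a => by
    have s := card_filter_mem_add_card_filter_not_mem u a
    omega
  have bw : ∀ c : Fin 4, (Finset.univ.filter fun j => c ∈ w j).card ≤ 5 := fun c => by
    have s := card_filter_mem_add_card_filter_not_mem w c
    omega
  obtain ⟨a₀, ha₀, ha₀'⟩ := exists_midDegree u hu
  obtain ⟨c₀, hc₀, hc₀'⟩ := exists_midDegree w hw
  have l10 := lock1 a₀ c₀
  have l20 := lock2 a₀ c₀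
  have bu0 := bu a₀
  have bw0 := bw c₀
  by_cases hmid : (Finset.univ.filter fun i => a₀ ∈ u i).card = 2 ∨
      (Finset.univ.filter fun i => a₀ ∈ u i).card = 3
  · -- `u` in the degree class, `w` a star
    refine chow_hit_dclass_star u w hu hw (fun a => ?_) (fun c => ?_)
    · have l1 := lock1 a c₀
      have l2 := lock2 a c₀
      omega
    · have l1 := lock1 a₀ c
      have l2 := lock2 a₀ c
      omega
  · -- mirrored: `w` in the degree class, `u` a star
    refine chow_hit_swap u w (chow_hit_dclass_star w u hw hu (fun c => ?_) (fun a => ?_))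
    · have l1 := lock1 a₀ c
      have l2 := lock2 a₀ c
      omega
    · have l1 := lock1 a c₀
      have l2 := lock2 a c₀
      omega

/-! ## G4. The bounded core engine and CPM for all minors of size `≤ 5` -/

/-- **Bounded core engine** (`chow_hit_of_core` with the size threaded): if every injective, LOCKED,
UNPEELABLE layout with `h + 1 ≤ r ≤ R` is hit, then every injective layout of size `r ≤ R` is hit, at
every height (the peel keeps the size, a split lowers it). -/
theorem chow_hit_of_core_le (R : ℕ)
    (core : ∀ (h r : ℕ) (u w : Fin r → Finset (Fin h)), r ≤ R → Function.Injective u →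
      Function.Injective w →
      (∀ (a c : Fin h) (β γ : Bool),
        (Finset.univ.filter fun i => (a ∈ u i ↔ β = true)).card ≠
          (Finset.univ.filter fun j => (c ∈ w j ↔ γ = true)).card) →
      (∀ a c : Fin h, ¬ (Function.Injective (fun i => (u i).erase a) ∧
        Function.Injective (fun j => (w j).erase c))) →
      h + 1 ≤ r →
      ∃ ℓ : Fin (h + h) → MvPolynomial (Fin (h + h)) ℂ, (∀ q, (ℓ q).totalDegree ≤ 1) ∧
        (Matrix.of fun i j : Fin r => coeff
          (∑ b ∈ u i, Finsupp.single (Fin.castAdd h b) 1 + ∑ d ∈ w j, Finsupp.single (Fin.natAdd h d) 1)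
          (∏ q, ℓ q)).det ≠ 0)
    (h r : ℕ) (hr : r ≤ R) (u w : Fin r → Finset (Fin h)) (hu : Function.Injective u)
    (hw : Function.Injective w) :
    ∃ ℓ : Fin (h + h) → MvPolynomial (Fin (h + h)) ℂ, (∀ q, (ℓ q).totalDegree ≤ 1) ∧
      (Matrix.of fun i j : Fin r => coeff
        (∑ b ∈ u i, Finsupp.single (Fin.castAdd h b) 1 + ∑ d ∈ w j, Finsupp.single (Fin.natAdd h d) 1)
        (∏ q, ℓ q)).det ≠ 0 := by
  classical
  induction h generalizing r with
  | zero => exact chow_hit_height_zero r u w hu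
  | succ h ih =>
    by_cases hpeel : ∃ a c : Fin (h + 1), Function.Injective (fun i => (u i).erase a) ∧
        Function.Injective (fun j => (w j).erase c)
    · obtain ⟨a, c, hua, hwc⟩ := hpeel
      exact chow_peel a c u w (ih _ hr _ _ (preimage_succAbove_injective_of_erase a u hua)
        (preimage_succAbove_injective_of_erase c w hwc))
    push Not at hpeel
    have hpeel' : ∀ a c : Fin (h + 1), ¬ (Function.Injective (fun i => (u i).erase a) ∧
        Function.Injective (fun j => (w j).erase c)) := fun a c hac => hpeel a c hac.1 hac.2
    have hsize : h + 1 + 1 ≤ r := by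
      by_cases hrow : ∀ a : Fin (h + 1), ¬ Function.Injective (fun i => (u i).erase a)
      · exact succ_le_of_unpeelable u (Nat.succ_pos h)
          (fun a => exists_erase_eq_of_not_injective u hu a (hrow a))
      · push Not at hrow
        obtain ⟨a, ha⟩ := hrow
        exact succ_le_of_unpeelable w (Nat.succ_pos h)
          (fun c => exists_erase_eq_of_not_injective w hw c (hpeel a c ha))
    by_cases hlk : ∀ (a c : Fin (h + 1)) (β γ : Bool),
        (Finset.univ.filter fun i => (a ∈ u i ↔ β = true)).card ≠
          (Finset.univ.filter fun j => (c ∈ w j ↔ γ = true)).card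
    · exact core (h + 1) r u w hr hu hw hlk hpeel' hsize
    push Not at hlk
    obtain ⟨a, c, β, γ, hk⟩ := hlk
    rw [card_filter_iff_eq, card_filter_iff_eq] at hk
    have hua := card_filter_mem_add_card_filter_not_mem u a
    have hwc := card_filter_mem_add_card_filter_not_mem w c
    have key : (Finset.univ.filter fun i => a ∉ u i).card = (Finset.univ.filter fun j => c ∉ w j).card ∨
        (Finset.univ.filter fun i => a ∉ u i).card = (Finset.univ.filter fun j => c ∈ w j).card := by
      cases β <;> cases γ <;> simp only [Bool.false_eq_true, if_false, if_true] at hk <;> omega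
    obtain ⟨k₀, hk₀⟩ : ∃ k₀, (Finset.univ.filter fun i => a ∉ u i).card = k₀ := ⟨_, rfl⟩
    rw [hk₀] at key hua
    obtain ⟨m, hkm⟩ : ∃ m, r = k₀ + m := ⟨r - k₀, by omega⟩
    subst hkm
    have hk₀R : k₀ ≤ R := by omega
    have hmR : m ≤ R := by omega
    obtain ⟨σ, hσ1, hσ2⟩ := exists_blockPerm (Finset.univ.filter fun i => a ∉ u i) hk₀
    have hu0 : ∀ i : Fin k₀, a ∉ u (σ (Fin.castAdd m i)) := fun i => by
      have := hσ1 i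
      rw [Finset.mem_filter] at this
      exact this.2
    have hu1 : ∀ i : Fin m, a ∈ u (σ (Fin.natAdd k₀ i)) := fun i => by
      have := hσ2 i
      rw [Finset.mem_filter] at this
      by_contra hna
      exact this ⟨Finset.mem_univ _, hna⟩
    have hU0 := preimage_succAbove_injective_of_not_mem a (fun i => u (σ (Fin.castAdd m i)))
      (fun i j hij => Fin.castAdd_injective _ _ (σ.injective (hu hij))) hu0
    have hU1 := preimage_succAbove_injective_of_mem a (fun i => u (σ (Fin.natAdd k₀ i)))
      (fun i j hij => Fin.natAdd_injective _ _ (σ.injective (hu hij))) hu1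
    rcases key with hkk | hkk
    · obtain ⟨τ, hτ1, hτ2⟩ := exists_blockPerm (Finset.univ.filter fun j => c ∉ w j) hkk.symm
      have hw0 : ∀ j : Fin k₀, c ∉ w (τ (Fin.castAdd m j)) := fun j => by
        have := hτ1 j
        rw [Finset.mem_filter] at this
        exact this.2
      have hw1 : ∀ j : Fin m, c ∈ w (τ (Fin.natAdd k₀ j)) := fun j => by
        have := hτ2 j
        rw [Finset.mem_filter] at this
        by_contra hnc
        exact this ⟨Finset.mem_univ _, hnc⟩
      have hW0 := preimage_succAbove_injective_of_not_mem c (fun j => w (τ (Fin.castAdd m j)))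
        (fun i j hij => Fin.castAdd_injective _ _ (τ.injective (hw hij))) hw0
      have hW1 := preimage_succAbove_injective_of_mem c (fun j => w (τ (Fin.natAdd k₀ j)))
        (fun i j hij => Fin.natAdd_injective _ _ (τ.injective (hw hij))) hw1
      exact chow_hit_of_perm u w σ τ (chow_pairSplit a c (fun i => u (σ i)) (fun j => w (τ j))
        hu0 hu1 hw0 hw1 (ih k₀ hk₀R _ _ hU0 hW0) (ih m hmR _ _ hU1 hW1))
    · obtain ⟨τ, hτ1, hτ2⟩ := exists_blockPerm (Finset.univ.filter fun j => c ∈ w j) hkk.symm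
      have hw0 : ∀ j : Fin k₀, c ∈ w (τ (Fin.castAdd m j)) := fun j => by
        have := hτ1 j
        rw [Finset.mem_filter] at this
        exact this.2
      have hw1 : ∀ j : Fin m, c ∉ w (τ (Fin.natAdd k₀ j)) := fun j => by
        have := hτ2 j
        rw [Finset.mem_filter] at this
        intro hc
        exact this ⟨Finset.mem_univ _, hc⟩
      have hW0 := preimage_succAbove_injective_of_mem c (fun j => w (τ (Fin.castAdd m j)))
        (fun i j hij => Fin.castAdd_injective _ _ (τ.injective (hw hij))) hw0
      have hW1 := preimage_succAbove_injective_of_not_mem c (fun j => w (τ (Fin.natAdd k₀ j)))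
        (fun i j hij => Fin.natAdd_injective _ _ (τ.injective (hw hij))) hw1
      exact chow_hit_of_perm u w σ τ (chow_pairSplit_mixed a c (fun i => u (σ i)) (fun j => w (τ j))
        hu0 hu1 hw0 hw1 (ih k₀ hk₀R _ _ hU0 hW0) (ih m hmR _ _ hU1 hW1))

/-- **CPM for ALL partition minors of size `r ≤ 5`, at EVERY height `h`** (item 20172's conclusion on
every injective layout pair `u w : Fin r → Finset (Fin h)` with `r ≤ 5`): by the bounded core engine a
core layout has `h + 1 ≤ r ≤ 5`, so either `h ≤ 3` (`chowHits_of_height_le_three`) or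
`(h, r) = (4, 5)` (`chow_hit_locked_four_five`). -/
theorem chowHits_of_size_le_five (h r : ℕ) (hr : r ≤ 5) (u w : Fin r → Finset (Fin h))
    (hu : Function.Injective u) (hw : Function.Injective w) :
    ∃ ℓ : Fin (h + h) → MvPolynomial (Fin (h + h)) ℂ, (∀ q, (ℓ q).totalDegree ≤ 1) ∧
      (Matrix.of fun i j : Fin r => coeff
        (∑ b ∈ u i, Finsupp.single (Fin.castAdd h b) 1 + ∑ d ∈ w j, Finsupp.single (Fin.natAdd h d) 1)
        (∏ q, ℓ q)).det ≠ 0 := by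
  refine chow_hit_of_core_le 5 (fun h r u w hr hu hw hlk _ hsz => ?_) h r hr u w hu hw
  by_cases h3 : h ≤ 3
  · exact chowHits_of_height_le_three h r h3 u w hu hw
  · obtain rfl : h = 4 := by omega
    obtain rfl : r = 5 := by omega
    exact chow_hit_locked_four_five u w hu hw hlk


end

end Summit.ValiantsHypothesis.ValiantsHypothesis.Theorems.BarrierLever.ChowFactor
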